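import Literature.AnabelianGeometry.SemiGraphs.ArithSemiGraphGaloisNonVacuity
import Literature.AnabelianGeometry.SemiGraphs.CharacteristicOpenCoreExhaustive
import Literature.AnabelianGeometry.SemiGraphs.ArithmeticCurves
import Literature.NumberTheory.LocalFields.PadicGaloisSecondCountable
import Literature.AnabelianGeometry.AbsoluteAnabelian.MLFAbsoluteGaloisGroupInfinite
import HarnessLib

/-!
# [SemiAnbd] Example 5.6: the tower record `StableReductionTower` inhabited with GENUINE, INFINITE
# arithmetic components `π̂₁(A_i) = charOpenCore(G_{ℚ_p}, i)` (non-vacuity; no geometry)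

Mochizuki, *Semi-graphs of anabelioids*, Publ. RIMS **42** (2006), §5, Example 5.6, manuscript p. 67: "an
exhaustive sequence of open characteristic subgroups of finite index … `⊆ M_i ⊆ … ⊆ Π`", "the arithmetic
semi-graphs of anabelioids `𝔊_i`, `𝔊^c_i`" with arithmetic fundamental groups "`M_i/N_i ⊆ Π/Δ = G_K`"
[cite: MochizukiSemiAnbd2006, Ex 5.6, p. 67].

PROOF-ONLY file (abc-iut cell, layer L3, NV lane; seat abc-iut-w6-d108, row «NV-L3 StableReductionTower-GQp»;
theorems only — no `def`, no `instance`, no new named fact).  abc-iut-L3-t7's `StableReductionTowerNonVacuity`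
(`StableReductionTower.nonempty_of_subsingleton`) inhabits the record over a `D` with TRIVIAL `Π`, and records
(with abc-iut-w6-d055's finding (F) of `OriginCertificatesNonVacuity`) that a tower with NON-trivial arithmetic
components needs "a `D` over a field with non-trivial `G_K` AND an exhaustive chain of open characteristic
finite-index subgroups of its `Π` (for `Π ⊇ G_{ℚ_p}`: topological finite generation of `G_{ℚ_p}` … not in the
tree; recorded, not claimed)".  The three inputs are now kernel theorems, and this file ASSEMBLES them:

* topological finite generation of `G_K` — GAP G-L4t4-2, closed by abc-iut-L4-d1 (Literature form modulo
  the named fact `localEulerPoincareCharacteristic`, p419680; unconditional Summits-side, p421667); carried here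
  as an explicit hypothesis `hA` resp. modulo the EPC fact BY NAME;
* the exhaustive characteristic chain `M_i := charOpenCore G_{ℚ_p} i` — abc-iut-w4-d053's
  `CharacteristicOpenCore` + `CharacteristicOpenCoreExhaustive` (`charOpenCore_isMTower_of_tfg`, p436481);
* the levels: `ArithSemiGraph (SemiAnbdVocab.ofReal R)` with arithmetic component ANY open `U ≤ G_K` and its
  continuous injective `π̂₁(A) → G_K` of range `U` (`ArithSemiGraph.exists_ofReal_openSubgroup_absoluteGaloisGroup_of_tfg`,
  p434438) on abc-iut-w6-d117's one-vertex edgeless Example 2.10 model.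

Result: `StableReductionTower.exists_galoisQp_of_tfg` / `…_of_localEPC` — over `D := (Π := G_{ℚ_p}, aug := id)`
(tempered by `IsTempered.of_profinite`, slim by `galoisMLF_slim_holds`, second countable by
`secondCountableTopology_absoluteGaloisGroup_padic`) there is a `StableReductionTower (SemiAnbdVocab.ofReal R) D`
with `M_i = charOpenCore G_{ℚ_p} i` (open, finite index, characteristic, antitone, exhaustive) and
`π̂₁(A_i) ≅ M_i` via `arithEmb`; admissible kernels trivial, decomposition representatives `⊤`, specialisation
maps `inl` (L3-t7's template on the geometric side).

HONEST LABEL (up front).  GENUINE ARITHMETIC, NO GEOMETRY: `Δ = Ker(aug) = 1` — no hyperbolic curve has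
trivial geometric fundamental group, the levels are one-vertex edgeless graphs with the trivial action, the
decomposition data are the maximal choice the record permits.  This closes a recorded non-vacuity finding in
the kernel (the arithmetic half of Example 5.6 is realisable with the cell's typed objects); it is NOT the
stable-reduction tower of a curve, and no `StableReductionOrigin` certificate is issued for it here.
Instantiated ≠ endorsed; nothing of [SemiAnbd] is asserted; no side is taken on [IUTchIII] Cor. 3.12.
-/

noncomputable section

namespace Literature.AnabelianGeometry.SemiGraphs

open _root_.CategoryTheory Field SgAQuot
open Literature.AlgebraicGeometry.Frobenioids (IsSlimGroup)
open Literature.AnabelianGeometry.AbsoluteAnabelian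
open Literature.NumberTheory.GaloisRepresentations
open Literature.NumberTheory.LocalFields

universe u

/-! ### Folklore helpers (the trivial kernel) -/

/-- A topological group with one element is tempered ([SemiAnbd] Def. 3.1 (i): all clauses trivial;
private copy of abc-iut-L3-t7's helper). [folklore] -/
private theorem isTempered_of_subsingleton'' (G : Type u) [Group G] [TopologicalSpace G]
    [Subsingleton G] : IsTempered G where
  basis U hU :=
    ⟨{ toOpenSubgroup := ⊤
       isNormal' := by change (⊤ : Subgroup G).Normal; infer_instance },
      inferInstance, fun g _ => by rw [Subsingleton.elim g 1]; exact mem_of_mem_nhds hU⟩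
  separated g hg := absurd (Subsingleton.elim g 1) hg
  complete x _ := ⟨1, fun N => by
    obtain ⟨g, hg⟩ := QuotientGroup.mk_surjective (x N)
    rw [← hg, Subsingleton.elim g 1]⟩

/-- A topological group with one element is slim. [folklore] -/
private theorem isSlimGroup_of_subsingleton'' (G : Type u) [Group G] [TopologicalSpace G]
    [Subsingleton G] : IsSlimGroup G :=
  ⟨fun _ _ => Subsingleton.elim _ _⟩

/-! ### The arithmetic datum `Π := G_K`, `aug := id` -/

/-- **The purely arithmetic Example 3.10 datum over a finite extension `K` of `ℚ_p` with second countable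
`G_K`**: `Π := G_K`, `aug := id` (so `Δ = 1`), tempered as a profinite group, slim by `galoisMLF_slim_holds`.
HONEST: not the tempered fundamental group of any curve (`Δ = 1`). [cite: MochizukiSemiAnbd2006, Ex 3.10 p.43] -/
theorem TemperedArithmeticGroup.exists_arithmetic (p : ℕ) [Fact p.Prime] (K : Type) [Field K]
    [Algebra ℚ_[p] K] [FiniteDimensional ℚ_[p] K] [CharZero K]
    (hsc : SecondCountableTopology (absoluteGaloisGroup K)) :
    ∃ D : TemperedArithmeticGroup K, ∃ e : D.Pi ≃ₜ* absoluteGaloisGroup K,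
      (∀ g, D.aug g = e g) ∧ D.delta = ⊥ := by
  have hker : Subsingleton ↥(ContinuousMonoidHom.id (absoluteGaloisGroup K)).toMonoidHom.ker :=
    ⟨fun a b => Subtype.ext ((MonoidHom.mem_ker.mp a.2).trans (MonoidHom.mem_ker.mp b.2).symm)⟩
  refine ⟨{ Pi := absoluteGaloisGroup K
            isTempered := IsTempered.of_profinite
            aug := ContinuousMonoidHom.id _
            aug_surjective := Function.surjective_id
            isTempered_ker := isTempered_of_subsingleton'' _
            isSlimGroup := galoisMLF_slim_holds p K
            isSlimGroup_ker := isSlimGroup_of_subsingleton'' _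
            secondCountableTopology := hsc }, ContinuousMulEquiv.refl _, fun _ => rfl, ?_⟩
  exact (MonoidHom.ker_eq_bot_iff _).mpr Function.injective_id

/-! ### The tower -/

/-- **`StableReductionTower` with genuine, infinite arithmetic components over `G_K`** (`K/ℚ_p` finite,
`G_K` second countable), GIVEN Def 5.1 (i)(a) "`G_K` topologically finitely generated": over the arithmetic
datum `Π := G_K` (`aug = id`, `Δ = 1`) there is a tower with `M_i := charOpenCore G_K i` — OPEN, FINITE
INDEX, CHARACTERISTIC, ANTITONE, EXHAUSTIVE (p436481) — whose levels `𝔊_i = 𝔊^c_i` are connected arithmetic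
semi-graphs of anabelioids over `SemiAnbdVocab.ofReal R` with `π̂₁(A_i) ↪ G_K` of image EXACTLY `M_i`
(p434438), trivial admissible kernels, decomposition representatives `⊤`, specialisation maps `inl`.
HONEST: no geometry (`Δ = 1`, one-vertex levels, trivial action). [cite: MochizukiSemiAnbd2006, Ex 5.6, p. 67] -/
theorem StableReductionTower.exists_absoluteGaloisGroup_of_tfg (R : SgA.BridgeResidual.{0, 1, 0})
    (p : ℕ) [Fact p.Prime] (K : Type) [Field K] [Algebra ℚ_[p] K] [FiniteDimensional ℚ_[p] K] [CharZero K]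
    (hsc : SecondCountableTopology (absoluteGaloisGroup K))
    (hA : IsTopologicallyFinitelyGenerated (absoluteGaloisGroup K)) :
    ∃ (D : TemperedArithmeticGroup K) (e : D.Pi ≃ₜ* absoluteGaloisGroup K)
      (T : StableReductionTower (SemiAnbdVocab.ofReal R) D),
      (∀ g, D.aug g = e g) ∧ D.delta = ⊥ ∧
      (∀ i, T.M i = charOpenCore D.Pi i) ∧ (∀ i, (T.arithEmb i).range = (T.M i).map D.aug.toMonoidHom) ∧
      (∀ i, T.admKer i = ⊥) := by
  classical
  obtain ⟨D, e, he, hdelta⟩ := TemperedArithmeticGroup.exists_arithmetic p K hsc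
  -- transport (a) and the profinite structure along `e` (here `e = id`, but we only use what is exposed)
  haveI : CompactSpace D.Pi := e.symm.toHomeomorph.compactSpace
  haveI : T2Space D.Pi := e.symm.toHomeomorph.t2Space
  haveI : TotallyDisconnectedSpace D.Pi := e.symm.toHomeomorph.totallyDisconnectedSpace
  have hAD : IsTopologicallyFinitelyGenerated D.Pi := hA.of_continuousMulEquiv e.symm
  obtain ⟨hMo, hMfi, hMchar, hManti, hMexh⟩ := charOpenCore_isMTower_of_tfg hAD
  -- the images `aug(M_i) ≤ G_K` are open
  have haug : ∀ i, IsOpen (((charOpenCore D.Pi i).map D.aug.toMonoidHom : Subgroup (absoluteGaloisGroup K)) :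
      Set (absoluteGaloisGroup K)) := by
    intro i
    have hset : (((charOpenCore D.Pi i).map D.aug.toMonoidHom : Subgroup (absoluteGaloisGroup K)) :
        Set (absoluteGaloisGroup K)) = e '' (charOpenCore D.Pi i : Set D.Pi) := by
      ext x
      simp only [Subgroup.coe_map, Set.mem_image, SetLike.mem_coe]
      constructor
      · rintro ⟨g, hg, rfl⟩; exact ⟨g, hg, (he g).symm⟩
      · rintro ⟨g, hg, rfl⟩; exact ⟨g, hg, he g⟩
    rw [hset]
    exact e.toHomeomorph.isOpenMap _ (hMo i)
  -- the levels: ArithSemiGraphs with arithmetic component `aug(M_i)` and their embeddings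
  choose 𝔊 emb hinj hrange _hρ hU hE using fun i =>
    ArithSemiGraph.exists_ofReal_openSubgroup_absoluteGaloisGroup_of_tfg R p K hA
      ((charOpenCore D.Pi i).map D.aug.toMonoidHom) (haug i)
  have hnormal : ∀ i, ((⊥ : Subgroup D.Pi).subgroupOf (charOpenCore D.Pi i)).Normal := fun i => by
    rw [Subgroup.bot_subgroupOf]; infer_instance
  -- decomposition data at a level: representatives `⊤`, no abutments recorded (L3-t7's template)
  let dec : ∀ i, DecompositionData (towerGroup (charOpenCore D.Pi i) (⊥ : Subgroup D.Pi))
      ((SemiAnbdVocab.ofReal R).Vert (𝔊 i).G) (Σ e : (SemiAnbdVocab.ofReal R).Edge (𝔊 i).G,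
        (SemiAnbdVocab.ofReal R).Br e) := fun i =>
    { E := Σ e : (SemiAnbdVocab.ofReal R).Edge (𝔊 i).G, (SemiAnbdVocab.ofReal R).Br e
      edgeOf := id
      abut := fun _ => none
      vertGp := fun _ => ⊤
      brGp := fun _ => ⊤
      brGp_le_vertGp := fun _ _ _ => le_top }
  refine ⟨D, e,
    { M := fun i => charOpenCore D.Pi i
      isOpen_M := hMo
      finiteIndex_M := hMfi
      characteristic_M := hMchar
      antitone_M := hManti
      exhaustive_M := hMexh
      𝔊 := 𝔊
      𝔊c := 𝔊
      arithEmb := fun i => (emb i).toMonoidHom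
      continuous_arithEmb := fun i => (emb i).continuous
      injective_arithEmb := hinj
      range_arithEmb := hrange
      arithEmbc := fun i => (emb i).toMonoidHom
      continuous_arithEmbc := fun i => (emb i).continuous
      injective_arithEmbc := hinj
      range_arithEmbc := hrange
      admKer := fun _ => ⊥
      admKer_le := fun _ => bot_le
      admKer_normal := hnormal
      admKer_mono := fun _ _ _ => le_rfl
      dec := dec
      decc := dec
      spV := fun _ j _ _ => Sum.inl (hU j).some.default
      spE := fun i _ _ x => ((hE i).false x).elim
      spVc := fun _ j _ _ => Sum.inl (hU j).some.default
      spEc := fun i _ _ x => ((hE i).false x).elim },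
    he, hdelta, fun _ => rfl, hrange, fun _ => rfl⟩

/-- In ANY tower over a `D` with INFINITE `Π` and INJECTIVE augmentation, every arithmetic component
`π̂₁(A_i)` is infinite: it maps onto `aug(M_i) ≅ M_i`, a finite-index subgroup of an infinite group.
[cite: MochizukiSemiAnbd2006, Ex 5.6, p. 67] -/
theorem StableReductionTower.infinite_PA_of_injective {K : Type u} [Field K] {D : TemperedArithmeticGroup K}
    [Infinite D.Pi] (haug : Function.Injective D.aug)
    {Obj : Type*} [Category Obj] {𝓥 : SemiAnbdVocab Obj} (T : StableReductionTower 𝓥 D) (i : ℕ) :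
    Infinite (T.𝔊 i).PA := by
  classical
  haveI := T.finiteIndex_M i
  -- `M_i` is infinite: `[Π : M_i] · #M_i = #Π = 0` with `[Π : M_i] ≠ 0`
  haveI hM : Infinite (T.M i) := by
    have h := (T.M i).index_mul_card
    have h0 : Nat.card D.Pi = 0 := Nat.card_eq_zero_of_infinite
    rw [h0] at h
    rcases Nat.card_eq_zero.mp ((Nat.mul_eq_zero.mp h).resolve_left Subgroup.FiniteIndex.index_ne_zero) with
      h' | h'
    · exact (h'.false ⟨1, (T.M i).one_mem⟩).elim
    · exact h'
  -- `aug(M_i)` is infinite (`aug` injective), and `π̂₁(A_i)` maps ONTO it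
  haveI : Infinite ((T.M i).map D.aug.toMonoidHom) :=
    Infinite.of_injective (fun m : T.M i => (⟨D.aug m, ⟨m, m.2, rfl⟩⟩ : (T.M i).map D.aug.toMonoidHom))
      fun a b h => Subtype.ext (haug (congrArg Subtype.val h))
  haveI : Infinite (T.arithEmb i).range := by rw [T.range_arithEmb i]; infer_instance
  exact Infinite.of_surjective _ (T.arithEmb i).rangeRestrict_surjective

/-- **The tower over `G_{ℚ_p}` itself**, given (a) (second countability of `G_{ℚ_p}` is the tree's
`secondCountableTopology_absoluteGaloisGroup_padic`); its arithmetic components `π̂₁(A_i) ≅ charOpenCore(G_{ℚ_p}, i)`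
are INFINITE (`Padic.infinite_absoluteGaloisGroup`). [cite: MochizukiSemiAnbd2006, Ex 5.6, p. 67] -/
theorem StableReductionTower.exists_galoisQp_of_tfg (R : SgA.BridgeResidual.{0, 1, 0}) (p : ℕ) [Fact p.Prime]
    (hA : IsTopologicallyFinitelyGenerated (absoluteGaloisGroup ℚ_[p])) :
    ∃ (D : TemperedArithmeticGroup ℚ_[p]) (e : D.Pi ≃ₜ* absoluteGaloisGroup ℚ_[p])
      (T : StableReductionTower (SemiAnbdVocab.ofReal R) D),
      (∀ g, D.aug g = e g) ∧ D.delta = ⊥ ∧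
      (∀ i, T.M i = charOpenCore D.Pi i) ∧ (∀ i, (T.arithEmb i).range = (T.M i).map D.aug.toMonoidHom) ∧
      (∀ i, T.admKer i = ⊥) ∧ (∀ i, Infinite (T.𝔊 i).PA) := by
  obtain ⟨D, e, T, he, hdelta, hM, hrange, hadm⟩ :=
    StableReductionTower.exists_absoluteGaloisGroup_of_tfg R p ℚ_[p]
      (secondCountableTopology_absoluteGaloisGroup_padic p) hA
  haveI : Infinite (absoluteGaloisGroup ℚ_[p]) := Padic.infinite_absoluteGaloisGroup p
  haveI : Infinite D.Pi := Infinite.of_injective e.symm e.symm.injective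
  have haug : Function.Injective D.aug := fun a b h => e.injective (by rw [← he, ← he, h])
  exact ⟨D, e, T, he, hdelta, hM, hrange, hadm, fun i => T.infinite_PA_of_injective haug i⟩

/-- **The tower over `G_{ℚ_p}`, modulo Tate's local Euler–Poincaré characteristic BY NAME** (L4-d1's carrying
of (a)). [cite: MochizukiSemiAnbd2006, Ex 5.6, p. 67] [cite: NeukirchSchmidtWingberg2008, Thm. 7.5.10] -/
theorem StableReductionTower.exists_galoisQp_of_localEPC
    (hEP : ∀ (F : Type) [Field F] [ValuativeRel F] [TopologicalSpace F] [IsNonarchimedeanLocalField F]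
      [CharZero F], localEulerPoincareCharacteristic F)
    (R : SgA.BridgeResidual.{0, 1, 0}) (p : ℕ) [Fact p.Prime] :
    ∃ (D : TemperedArithmeticGroup ℚ_[p]) (e : D.Pi ≃ₜ* absoluteGaloisGroup ℚ_[p])
      (T : StableReductionTower (SemiAnbdVocab.ofReal R) D),
      (∀ g, D.aug g = e g) ∧ D.delta = ⊥ ∧
      (∀ i, T.M i = charOpenCore D.Pi i) ∧ (∀ i, (T.arithEmb i).range = (T.M i).map D.aug.toMonoidHom) ∧
      (∀ i, T.admKer i = ⊥) ∧ (∀ i, Infinite (T.𝔊 i).PA) :=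
  StableReductionTower.exists_galoisQp_of_tfg R p
    (isTopologicallyFinitelyGenerated_absoluteGaloisGroup_padic_of_localEPC hEP p ℚ_[p])

end Literature.AnabelianGeometry.SemiGraphs

end
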